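import Summits.BirchSwinnertonDyer.BirchSwinnertonDyer.Theses.TangentCone
import Summits.BirchSwinnertonDyer.BirchSwinnertonDyer.Theorems.PAdicOrderV2PAdicOrderThesisR2StubUBPosEnvelope
import Summits.BirchSwinnertonDyer.BirchSwinnertonDyer.Theorems.TangentConeSelmerRankCMOrderLeCorankCMOfItems
import Literature.NumberTheory.EllipticCurves.KatoRankBound
import HarnessLib

/-!
# BirchSwinnertonDyer / TangentCone — crux `SelmerRankCM` (stmt-BirchSwinnertonDyer-18086), line
# `rubin-squeeze`, stub `stub_orderLeAnalyticRankCM` (the UB kernel): what the stub says cell by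
# cell, and what it costs beyond the crux

Support file (helper, `--supports`; it does NOT close the stub). The registered stub
`stub_orderLeAnalyticRankCM` of `Cruxes/SelmerRankCM/Lines/rubin_squeeze.lean` asks, for a CM curve
`E/ℚ` (globally minimal `W`), a good ordinary prime `p ≥ 5`, `2 ≤ r_an(E) = ord_{s=1} L(E,s)` and
any newform `f` of `E`, for `ord_{T=0} L_p(f, α_p, T) ≤ r_an(E)` — the CM column of clause UB2 of the
OPEN crux `PAdicOrderV2.PAdicOrderComparisonR2` (stmt-BirchSwinnertonDyer-0489). It is an open
problem (a Schneider-type non-degeneracy of the cyclotomic `p`-adic height in rank `≥ 2`; Bertrand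
1982 is rank one). This file records three kernel-checked facts about it, all with the deep inputs
either PROVED in the tree or entering as explicit named-fact hypotheses:

* `order_le_iff_coeff_two_ne_zero_of_analyticRank_eq_two` (CM-free, unconditional given the
  newform): at a good ordinary `p`, if `r_an(E) = 2` then `ord_T L_p ≤ r_an ↔ [T²] L_p ≠ 0`. Indeed
  `ord_T L_p` is finite (Rohrlich, `padicLFunction_ne_zero_holds`), has the parity of `r_an`
  (`stub_even_order_iff_even_analyticRank`: the `p`-adic and complex signs agree, Greenberg LNM 1716
  §5 p. 181) and is `≥ 1` (interpolation), so it is even and `≥ 2`; hence `≤ 2` iff `= 2` iff the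
  quadratic coefficient is non-zero. So the FIRST open cells of the stub are a pure non-vanishing
  statement about ONE `p`-adic number per cell — the quantity a finite-precision computation
  certifies (Stein–Wuthrich 2013 §3; PARI `ellpadicL`).
* `orderLeAnalyticRankCM_two_iff_coeff_two_ne_zero`: the `r_an = 2` column of the stub, as a
  `∀`-statement, is EQUIVALENT to "the quadratic coefficient of the cyclotomic `p`-adic `L`-function
  of a CM curve of analytic rank `2` never vanishes at a good ordinary `p ≥ 5`".
* `orderLeAnalyticRankCM_iff_order_lt_add_two`: the registered `∀`-statement is equivalent to its
  finite-precision form `ord_T L_p < r_an + 2` (parity excludes `r_an + 1`;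
  `order_le_analyticRank_iff_lt_add_two`).
* `cm_order_le_analyticRank_iff_selmerCorank_le_of_semisimple` and
  `orderLeAnalyticRankCM_iff_selmerCorankLe_of_bcs_of_semisimpleCM`: MODULO the printed main
  conjecture (`burungale_castella_skinner_charIdeal_eq_padicLFunction`; Rubin 1991 for CM, made
  applicable by the tree theorem `hasIrreducibleModPGaloisRep_of_hasCM_of_five_le`), modularity
  (`exists_isNewformOf`) and `T`-semisimplicity of `X(E/ℚ_∞) ⊗ ℚ_p` at `T = 0` for CM curves of
  analytic rank `≥ 2` (Greenberg Conj. 1.12; the line's LB kernel, here needed from `r_an = 2`), the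
  stub is EQUIVALENT to the upper-bound half `corank_{ℤ_p} Sel_{p^∞}(E/ℚ) ≤ r_an(E)` of the crux on
  `r_an ≥ 2` — i.e. the line's strengthening `C⁺` costs, on the UB side, exactly semisimplicity
  (through the landed `cm_order_eq_selmerCorank_iff_semisimple`).

References: B. Mazur, J. Tate, J. Teitelbaum, Invent. Math. 84 (1986) §I.17, §II.10; R. Greenberg,
LNM 1716 (1999) §1 Conj. 1.12, §5 p. 181; D. Rohrlich, Invent. Math. 75 (1984); W. Stein,
C. Wuthrich, Math. Comp. 82 (2013) §3; D. Bertrand, Progr. Math. 22 (1982).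
-/

-- single-conjunct summit: `Summit.BirchSwinnertonDyer.BirchSwinnertonDyer.…` repeats the name by design
set_option linter.dupNamespace false

namespace Summit.BirchSwinnertonDyer.BirchSwinnertonDyer.Theorems

open scoped TensorProduct
open Literature.NumberTheory.EllipticCurves
open Literature.NumberTheory.EllipticCurves.ModularForms (IsNewformOf exists_isNewformOf)
open Literature.NumberTheory.EllipticCurves.IwasawaAlgebra (mulTRat)
open Summit.BirchSwinnertonDyer.BirchSwinnertonDyer.Cruxes.PAdicOrderThesisR2.KatoSandwich
  (exists_order_padicLFunction_eq_natCast order_le_analyticRank_iff_lt_add_two)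

/-! ### The `r_an = 2` cells: the stub is `[T²] L_p ≠ 0` -/

/-- **At analytic rank `2`, `ord_T L_p ≤ r_an ↔ [T²] L_p ≠ 0`** (CM-free). For `E = W/ℚ` elliptic
and globally minimal, `p` good ordinary, `f` the newform of `E` (any level) and `r_an(E) = 2`:
`ord_{T=0} L_p(f, α_p, T) ≤ 2 ↔` the coefficient of `T²` in `L_p(f, α_p, T)` is non-zero. The order
is a natural number of the parity of `r_an` and non-zero when `r_an ≠ 0`
(`exists_order_padicLFunction_eq_natCast`: Rohrlich non-vanishing, equality of the `p`-adic and
complex signs, interpolation at the trivial character), so it is even and `≥ 2`.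
[cite: GreenbergLNM1716, §5 (p. 181)] -/
theorem order_le_iff_coeff_two_ne_zero_of_analyticRank_eq_two (W : WeierstrassCurve ℚ)
    [W.IsElliptic] [W.IsGloballyMinimal] (p : ℕ) [Fact p.Prime] (hord : IsOrdinaryAt W p)
    {N : ℕ} [NeZero N] {f : CuspForm (CongruenceSubgroup.Gamma0 N) 2} (hf : IsNewformOf W f)
    (h2 : W.analyticRank = 2) :
    (padicLFunction f (unitRoot W p : ℚ_[p])).order ≤ (W.analyticRank : ℕ∞) ↔
      PowerSeries.coeff 2 (padicLFunction f (unitRoot W p : ℚ_[p])) ≠ 0 := by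
  obtain ⟨n, hn, hpar, h0⟩ := exists_order_padicLFunction_eq_natCast W p hord hf
  rw [h2] at hpar h0 ⊢
  have hne : n ≠ 0 := fun h => absurd (h0.mp h) (by norm_num)
  have heven : Even n := hpar.mpr even_two
  have hn2 : 2 ≤ n := by obtain ⟨k, hk⟩ := heven; omega
  rw [hn]
  constructor
  · intro hle
    have hle' : n ≤ 2 := by exact_mod_cast hle
    have heq : n = 2 := le_antisymm hle' hn2
    rw [heq] at hn
    exact (PowerSeries.order_eq_nat.mp hn).1
  · intro hc
    rw [← hn]
    exact PowerSeries.order_le 2 hc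

/-- **The `r_an = 2` column of `stub_orderLeAnalyticRankCM` is a non-vanishing statement.** The
stub restricted to CM curves of analytic rank exactly `2` (left) is equivalent to: for every CM
curve `E/ℚ` (globally minimal `W`) with `ord_{s=1} L(E,s) = 2`, every good ordinary `p ≥ 5` and
the newform `f` of `E`, the quadratic coefficient `[T²] L_p(f, α_p, T)` is non-zero (right) —
pointwise `order_le_iff_coeff_two_ne_zero_of_analyticRank_eq_two`. (Registered sub-goal of
stmt-BirchSwinnertonDyer-18086, colon form.) [cite: GreenbergLNM1716, §5 (p. 181)] -/
theorem orderLeAnalyticRankCM_two_iff_coeff_two_ne_zero :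
    (∀ (W : WeierstrassCurve ℚ) [W.IsElliptic] [W.IsGloballyMinimal] (p : ℕ) [Fact p.Prime],
      5 ≤ p → W.HasGoodReductionAtPrime p → ¬ (p : ℤ) ∣ W.frobeniusTrace p → W.HasCM →
      W.analyticRank = 2 →
      ∀ {N : ℕ} [NeZero N] (f : CuspForm (CongruenceSubgroup.Gamma0 N) 2), IsNewformOf W f →
        (padicLFunction f (unitRoot W p : ℚ_[p])).order ≤ (W.analyticRank : ℕ∞)) ↔
    (∀ (W : WeierstrassCurve ℚ) [W.IsElliptic] [W.IsGloballyMinimal] (p : ℕ) [Fact p.Prime],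
      5 ≤ p → W.HasGoodReductionAtPrime p → ¬ (p : ℤ) ∣ W.frobeniusTrace p → W.HasCM →
      W.analyticRank = 2 →
      ∀ {N : ℕ} [NeZero N] (f : CuspForm (CongruenceSubgroup.Gamma0 N) 2), IsNewformOf W f →
        PowerSeries.coeff 2 (padicLFunction f (unitRoot W p : ℚ_[p])) ≠ 0) := by
  constructor
  · intro h W _ _ p _ h5 hgood hord hCM h2 N _ f hf
    exact (order_le_iff_coeff_two_ne_zero_of_analyticRank_eq_two W p ⟨hgood, hord⟩ hf h2).mp
      (h W p h5 hgood hord hCM h2 f hf)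
  · intro h W _ _ p _ h5 hgood hord hCM h2 N _ f hf
    exact (order_le_iff_coeff_two_ne_zero_of_analyticRank_eq_two W p ⟨hgood, hord⟩ hf h2).mpr
      (h W p h5 hgood hord hCM h2 f hf)

/-! ### The registered `∀`-statement in finite-precision form -/

/-- **`stub_orderLeAnalyticRankCM` ↔ its certifiable form `ord_T L_p < r_an + 2`.** The registered
statement of the stub (left, verbatim) is equivalent to the same statement with conclusion
`ord_{T=0} L_p(f, α_p, T) < r_an(E) + 2` (right): the value `r_an + 1` is excluded because the
`p`-adic and complex orders have the same parity (`order_le_analyticRank_iff_lt_add_two`). The right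
side is what a computation of `[T^0], …, [T^{r_an+1}]` to finite `p`-adic precision can certify at
a cell. (Registered sub-goal of stmt-BirchSwinnertonDyer-18086, colon form.)
[cite: GreenbergLNM1716, §5 (p. 181)] -/
theorem orderLeAnalyticRankCM_iff_order_lt_add_two :
    (∀ (W : WeierstrassCurve ℚ) [W.IsElliptic] [W.IsGloballyMinimal] (p : ℕ) [Fact p.Prime],
      5 ≤ p → W.HasGoodReductionAtPrime p → ¬ (p : ℤ) ∣ W.frobeniusTrace p → W.HasCM →
      2 ≤ W.analyticRank →
      ∀ {N : ℕ} [NeZero N] (f : CuspForm (CongruenceSubgroup.Gamma0 N) 2), IsNewformOf W f →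
        (padicLFunction f (unitRoot W p : ℚ_[p])).order ≤ (W.analyticRank : ℕ∞)) ↔
    (∀ (W : WeierstrassCurve ℚ) [W.IsElliptic] [W.IsGloballyMinimal] (p : ℕ) [Fact p.Prime],
      5 ≤ p → W.HasGoodReductionAtPrime p → ¬ (p : ℤ) ∣ W.frobeniusTrace p → W.HasCM →
      2 ≤ W.analyticRank →
      ∀ {N : ℕ} [NeZero N] (f : CuspForm (CongruenceSubgroup.Gamma0 N) 2), IsNewformOf W f →
        (padicLFunction f (unitRoot W p : ℚ_[p])).order < ((W.analyticRank + 2 : ℕ) : ℕ∞)) := by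
  constructor
  · intro h W _ _ p _ h5 hgood hord hCM h2 N _ f hf
    exact (order_le_analyticRank_iff_lt_add_two W p ⟨hgood, hord⟩ hf).mp
      (h W p h5 hgood hord hCM h2 f hf)
  · intro h W _ _ p _ h5 hgood hord hCM h2 N _ f hf
    exact (order_le_analyticRank_iff_lt_add_two W p ⟨hgood, hord⟩ hf).mpr
      (h W p h5 hgood hord hCM h2 f hf)

/-! ### Modulo the main conjecture and `T`-semisimplicity the stub IS the crux's upper bound -/

/-- **Pointwise: under the main conjecture and `T`-semisimplicity at `(E, p)`, `ord_T L_p ≤ r_an ↔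
corank ≤ r_an`.** For a CM curve `E/ℚ` (globally minimal `W`), `p ≥ 5` good ordinary, the
cyclotomic `κ, γ` matching the variable, a dual datum `D` with `ker (T ⊗ 1)² = ker (T ⊗ 1)` on
`ℚ_p ⊗ X`, and the newform `f`: by `cm_order_eq_selmerCorank_iff_semisimple` (main conjecture
`burungale_castella_skinner_charIdeal_eq_padicLFunction` + Mazur control + structure theory)
`ord_T L_p = corank_{ℤ_p} Sel_{p^∞}(E/ℚ)`, whence the equivalence.
[cite: GreenbergLNM1716, §1 Conj. 1.12 and p. 65] -/
theorem cm_order_le_analyticRank_iff_selmerCorank_le_of_semisimple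
    (hBCS : burungale_castella_skinner_charIdeal_eq_padicLFunction)
    (W : WeierstrassCurve ℚ) [W.IsElliptic] [W.IsGloballyMinimal] (p : ℕ) [Fact p.Prime]
    (h5 : 5 ≤ p) (hgood : W.HasGoodReductionAtPrime p) (hord : ¬ (p : ℤ) ∣ W.frobeniusTrace p)
    (hCM : W.HasCM) {κ : ZpExtension ℚ p} {γ : Field.absoluteGaloisGroup ℚ}
    (hκ : κ.IsCyclotomic) (hγ : κ.IsTopGenerator γ) (hγ' : IsCyclotomicVariable p γ)
    (D : W.SelmerDualData κ γ) {N : ℕ} [NeZero N] (f : CuspForm (CongruenceSubgroup.Gamma0 N) 2)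
    (hf : IsNewformOf W f)
    (hSS : LinearMap.ker (mulTRat p D.X ∘ₗ mulTRat p D.X) = LinearMap.ker (mulTRat p D.X)) :
    (padicLFunction f (unitRoot W p : ℚ_[p])).order ≤ (W.analyticRank : ℕ∞) ↔
      W.selmerCorank p ≤ W.analyticRank := by
  rw [(cm_order_eq_selmerCorank_iff_semisimple hBCS W p h5 hgood hord hCM hκ hγ hγ' D f hf).mpr hSS]
  exact_mod_cast Iff.rfl

/-- **`stub_orderLeAnalyticRankCM` ↔ the upper-bound half of the crux on `r_an ≥ 2`, modulo
print and semisimplicity.** Hypotheses: the named facts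
`burungale_castella_skinner_charIdeal_eq_padicLFunction` (cyclotomic main conjecture; Rubin 1991
for CM) and `exists_isNewformOf` (modularity; Deuring–Hecke–Shimura for CM), and `T`-semisimplicity
of `ℚ_p ⊗ X(E/ℚ_∞)` at `T = 0` for CM curves of analytic rank `≥ 2` at good ordinary `p ≥ 5`
(Greenberg Conj. 1.12, OPEN from corank `2`, spelled out verbatim). Conclusion: the registered
statement of the stub (left, verbatim) is equivalent to `corank_{ℤ_p} Sel_{p^∞}(E/ℚ) ≤ r_an(E)` for
the same `(E, p)` (right) — the upper-bound half of `SelmerRankCM` on its open core. `→` reads the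
stub at the newform of `E` (`conductorNorm_pos_holds`); both directions use a cyclotomic datum
(`exists_isCyclotomic_isTopGenerator_isCyclotomicVariable_holds`), a dual datum
(`nonempty_selmerDualData_holds`) and `cm_order_le_analyticRank_iff_selmerCorank_le_of_semisimple`.
(Registered sub-goal of stmt-BirchSwinnertonDyer-18086, colon form.)
[cite: GreenbergLNM1716, §1 Conj. 1.12 and p. 65] -/
theorem orderLeAnalyticRankCM_iff_selmerCorankLe_of_bcs_of_semisimpleCM :
    burungale_castella_skinner_charIdeal_eq_padicLFunction → exists_isNewformOf →
    (∀ (W : WeierstrassCurve ℚ) [W.IsElliptic] [W.IsGloballyMinimal] (p : ℕ) [Fact p.Prime],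
      5 ≤ p → W.HasGoodReductionAtPrime p → ¬ (p : ℤ) ∣ W.frobeniusTrace p → W.HasCM →
      2 ≤ W.analyticRank →
      ∀ (κ : ZpExtension ℚ p) (γ : Field.absoluteGaloisGroup ℚ), κ.IsCyclotomic →
        κ.IsTopGenerator γ → IsCyclotomicVariable p γ → ∀ (D : W.SelmerDualData κ γ),
        LinearMap.ker (mulTRat p D.X ∘ₗ mulTRat p D.X) = LinearMap.ker (mulTRat p D.X)) →
    ((∀ (W : WeierstrassCurve ℚ) [W.IsElliptic] [W.IsGloballyMinimal] (p : ℕ) [Fact p.Prime],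
      5 ≤ p → W.HasGoodReductionAtPrime p → ¬ (p : ℤ) ∣ W.frobeniusTrace p → W.HasCM →
      2 ≤ W.analyticRank →
      ∀ {N : ℕ} [NeZero N] (f : CuspForm (CongruenceSubgroup.Gamma0 N) 2), IsNewformOf W f →
        (padicLFunction f (unitRoot W p : ℚ_[p])).order ≤ (W.analyticRank : ℕ∞)) ↔
    (∀ (W : WeierstrassCurve ℚ) [W.IsElliptic] [W.IsGloballyMinimal] (p : ℕ) [Fact p.Prime],
      5 ≤ p → W.HasGoodReductionAtPrime p → ¬ (p : ℤ) ∣ W.frobeniusTrace p → W.HasCM →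
      2 ≤ W.analyticRank → W.selmerCorank p ≤ W.analyticRank)) := by
  intro hBCS hmod hSS
  constructor
  · intro h W _ _ p _ h5 hgood hord hCM h2
    haveI : NeZero (W.conductorNorm ℤ) := ⟨(WeierstrassCurve.conductorNorm_pos_holds W).ne'⟩
    obtain ⟨f, hf⟩ := hmod W
    obtain ⟨κ, hκ, γ, hγ, hγ'⟩ := exists_isCyclotomic_isTopGenerator_isCyclotomicVariable_holds p
    obtain ⟨D⟩ := W.nonempty_selmerDualData_holds κ γ hγ
    exact (cm_order_le_analyticRank_iff_selmerCorank_le_of_semisimple hBCS W p h5 hgood hord hCM hκ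
      hγ hγ' D f hf (hSS W p h5 hgood hord hCM h2 κ γ hκ hγ hγ' D)).mp (h W p h5 hgood hord hCM h2 f hf)
  · intro h W _ _ p _ h5 hgood hord hCM h2 N _ f hf
    obtain ⟨κ, hκ, γ, hγ, hγ'⟩ := exists_isCyclotomic_isTopGenerator_isCyclotomicVariable_holds p
    obtain ⟨D⟩ := W.nonempty_selmerDualData_holds κ γ hγ
    exact (cm_order_le_analyticRank_iff_selmerCorank_le_of_semisimple hBCS W p h5 hgood hord hCM hκ
      hγ hγ' D f hf (hSS W p h5 hgood hord hCM h2 κ γ hκ hγ hγ' D)).mpr (h W p h5 hgood hord hCM h2)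

end Summit.BirchSwinnertonDyer.BirchSwinnertonDyer.Theorems
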